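import Literature.MathematicalPhysics.QuantumLattice.HeisenbergMarshallSameSublattice
import Literature.MathematicalPhysics.QuantumLattice.HeisenbergRPCorrelationBlocks
import Literature.MathematicalPhysics.QuantumLattice.HeisenbergOrderNeelGD
import HarnessLib

/-!
# R2 device D20 — tables for the `k×k`-FOLDED energy-free Marshall-augmented KLS programme

HONEST FRAMING: ladder R1–R4 with certified numbers; no claim on H/H₀. Cell pub-hubbard, seat r2
(gen 13). Every statement concerns ONE finite matrix, the spin-½ Heisenberg antiferromagnet on the
`2n × 2n` torus; nothing here bears on H₀.

FOLDING. Fix an even fold index `k` and a side `L = 2n = m·k`. The reduced two-point function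
`c(a,b) = ⟨Sᶻ_0 Sᶻ_(a,b)⟩₀` (`heisRedCorr2 (2n) 1 a b`) is summed over the `k²` residue classes
`F(ρ₁,ρ₂) = Σ_{a ≡ ρ₁, b ≡ ρ₂ (mod k)} c(a,b)`. At the `k²` momenta `q = (2π/k)(s₁,s₂)` of the
`L`-torus the structure factor is a FIXED linear form in the `F`'s, `ĝ_q = Σ_ρ cos(2π(s·ρ)/k) F(ρ)`
(`heisStructureFactor_fold`), `Q = (π,π)` is among them (`heisStructureFactor_neel_fold`), and every
in-tree input of the Kennedy–Lieb–Shastry programme folds with it: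
* (I) the `T = 0` infrared bound `ĝ_q² E_(q-Q) ≤ (-ε/2) E_q` (`heis_infraredBound`), here in the
  tangent form `2g₀ĝ_q ≤ g₀² + (E_q / 2E_(q-Q))(-ε)` (`ir_fold_tangent`) and the singlet rule
  `Σ_ρ F(ρ) = ĝ_0 = 0` (`fold_singlet`), with `ε = (c(1,0)+c(0,1))/2` FREE;
* (M) Marshall's sign rule (`heisRedCorr2_nonneg_of_even/nonpos_of_odd`, Marshall 1955 /
  Lieb–Mattis 1962): `F(ρ) ≥ 0` for `ρ₁+ρ₂` even, `≤ 0` for `ρ₁+ρ₂` odd (`foldClass_nonneg/nonpos`),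
  `F(0,0) ≥ c(0,0) = ¼` (`foldClass_zero_zero_ge`), and `F(ρ) ≤ c(a₀,b₀)` for any member of an odd
  class (`foldClass_le_single`; used with `c(0,1), c(0,L-1) = c(0,1), c(1,0), c(L-1,0) = c(1,0)`).
The resulting finite linear programme in the `k² + 2` unknowns `F(ρ), c(0,1), c(1,0)` has the SAME
constraints for every `L ∈ kℕ`, so one `linarith` certificate proves `ĝ_Q ≥ γ_k`, i.e.
`m_s²(L) = 3ĝ_Q/L² ≥ 3γ_k/L²`, uniformly in `L` (rows: `NeelFoldFourFloor`, `NeelFoldSixFloor`;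
the `k = 2` fold is `NeelMarshallInfraredFloor`, in closed form).

References: T. Kennedy, E. H. Lieb, B. S. Shastry, J. Stat. Phys. 53 (1988) 1019, eqs. (12)–(19),
p. 1021; E. Lieb, D. Mattis, J. Math. Phys. 3 (1962) 749, Thm 2; W. Marshall, Proc. Roy. Soc.
A 232 (1955) 48.
-/

noncomputable section

open Finset Literature.MathematicalPhysics.QuantumLattice Literature.Probability.LatticeModels

namespace Summit.HubbardSuperconductivity.HubbardLadder

/-! ### Folding of the cosine weights and of double sums -/

/-- `cos(2π (mX mod mk)/(mk)) = cos(2π (X mod k)/k)`. [folklore] -/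
theorem cosNat_fold (L m k X : ℕ) (hL : L = m * k) (hm : m ≠ 0) (hk : k ≠ 0) :
    cosNat L ((m * X) % L) = cosNat k (X % k) := by
  subst hL
  rw [Nat.mul_mod_mul_left]
  unfold cosNat
  have hm' : (m : ℝ) ≠ 0 := by exact_mod_cast hm
  have hk' : (k : ℝ) ≠ 0 := by exact_mod_cast hk
  push_cast
  rw [show 2 * Real.pi * ((m : ℝ) * ((X % k : ℕ) : ℝ)) / ((m : ℝ) * (k : ℝ)) =
      2 * Real.pi * ((X % k : ℕ) : ℝ) / (k : ℝ) by field_simp]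

/-- Regrouping a double sum over `[0,L)²` with residue-class weights into the `k²` class sums.
[folklore] -/
theorem sum_fold (L k s₁ s₂ : ℕ) (hk : 0 < k) (w : ℕ → ℝ) (c : ℕ → ℕ → ℝ) (F : ℕ → ℕ → ℝ)
    (hF : ∀ ρ₁ ρ₂, F ρ₁ ρ₂ = ∑ a ∈ (range L).filter (fun a => a % k = ρ₁),
        ∑ b ∈ (range L).filter (fun b => b % k = ρ₂), c a b) :
    ∑ a ∈ range L, ∑ b ∈ range L, w ((s₁ * a + s₂ * b) % k) * c a b =
      ∑ ρ₁ ∈ range k, ∑ ρ₂ ∈ range k, w ((s₁ * ρ₁ + s₂ * ρ₂) % k) * F ρ₁ ρ₂ := by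
  have hmaps : ∀ a ∈ range L, a % k ∈ range k := fun a _ => mem_range.2 (Nat.mod_lt a hk)
  rw [← sum_fiberwise_of_maps_to hmaps]
  refine sum_congr rfl fun ρ₁ _ => ?_
  have inner : ∀ a ∈ (range L).filter (fun a => a % k = ρ₁),
      ∑ b ∈ range L, w ((s₁ * a + s₂ * b) % k) * c a b =
        ∑ ρ₂ ∈ range k, w ((s₁ * ρ₁ + s₂ * ρ₂) % k) *
          ∑ b ∈ (range L).filter (fun b => b % k = ρ₂), c a b := by
    intro a ha
    have haρ : a % k = ρ₁ := (mem_filter.1 ha).2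
    rw [← sum_fiberwise_of_maps_to hmaps]
    refine sum_congr rfl fun ρ₂ _ => ?_
    rw [mul_sum]
    refine sum_congr rfl fun b hb => ?_
    have hbρ : b % k = ρ₂ := (mem_filter.1 hb).2
    have e : (s₁ * a + s₂ * b) % k = (s₁ * ρ₁ + s₂ * ρ₂) % k := by
      rw [← haρ, ← hbρ]
      exact (((Nat.mod_modEq a k).mul_left s₁).add ((Nat.mod_modEq b k).mul_left s₂)).symm
    rw [e]
  rw [sum_congr rfl inner, sum_comm]
  refine sum_congr rfl fun ρ₂ _ => ?_
  rw [hF, mul_sum]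

/-! ### The folded structure factors -/

section Fold

variable (n m k : ℕ)

/-- **Folded structure factor**: at the momentum `(2π/k)(s₁,s₂)` of the `2n`-torus (`2n = mk`),
`ĝ_q = Σ_ρ cos(2π(s₁ρ₁+s₂ρ₂)/k) F(ρ)`. [cite: KLS1988JSP, p. 1021] -/
theorem heisStructureFactor_fold [NeZero (2 * n)] (s₁ s₂ : ℕ) (hL : 2 * n = m * k) (hm : m ≠ 0)
    (hk : k ≠ 0) (F : ℕ → ℕ → ℝ)
    (hF : ∀ ρ₁ ρ₂, F ρ₁ ρ₂ = ∑ a ∈ (range (2 * n)).filter (fun a => a % k = ρ₁),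
        ∑ b ∈ (range (2 * n)).filter (fun b => b % k = ρ₂), heisRedCorr2 (2 * n) 1 a b) :
    heisStructureFactor 0 (2 * n) 1
        ![((m * s₁ : ℕ) : ZMod (2 * n)), ((m * s₂ : ℕ) : ZMod (2 * n))] =
      ∑ ρ₁ ∈ range k, ∑ ρ₂ ∈ range k, cosNat k ((s₁ * ρ₁ + s₂ * ρ₂) % k) * F ρ₁ ρ₂ := by
  rw [heisStructureFactor_two_eq_sum_range,
    ← sum_fold (2 * n) k s₁ s₂ (Nat.pos_of_ne_zero hk) (cosNat k) _ F hF]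
  refine sum_congr rfl fun a _ => sum_congr rfl fun b _ => ?_
  rw [show m * s₁ * a + m * s₂ * b = m * (s₁ * a + s₂ * b) by ring, cosNat_fold (2 * n) m k _ hL hm hk]

/-- **Folded structure factor at `Q = (π,π)`** (`k = 2j`, `n = mj`): `ĝ_Q = Σ_ρ cos(2π j(ρ₁+ρ₂)/k) F(ρ)`.
[cite: KLS1988JSP, p. 1021] -/
theorem heisStructureFactor_neel_fold [NeZero (2 * n)] (j : ℕ) (hL : 2 * n = m * k)
    (hnj : n = m * j) (hm : m ≠ 0) (hk : k ≠ 0) (F : ℕ → ℕ → ℝ)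
    (hF : ∀ ρ₁ ρ₂, F ρ₁ ρ₂ = ∑ a ∈ (range (2 * n)).filter (fun a => a % k = ρ₁),
        ∑ b ∈ (range (2 * n)).filter (fun b => b % k = ρ₂), heisRedCorr2 (2 * n) 1 a b) :
    heisStructureFactor 0 (2 * n) 1 (neelIndex (2 * n) : TorusSite 2 (2 * n)) =
      ∑ ρ₁ ∈ range k, ∑ ρ₂ ∈ range k, cosNat k ((j * ρ₁ + j * ρ₂) % k) * F ρ₁ ρ₂ := by
  have hQ : (neelIndex (2 * n) : TorusSite 2 (2 * n)) =
      ![((m * j : ℕ) : ZMod (2 * n)), ((m * j : ℕ) : ZMod (2 * n))] := by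
    have e : 2 * n / 2 = m * j := by rw [Nat.mul_div_cancel_left n (by norm_num), hnj]
    ext i; fin_cases i <;> simp [neelIndex, e]
  rw [hQ]
  exact heisStructureFactor_fold n m k j j hL hm hk F hF

/-- **Folded infrared bound** at `q = (2π/k)(s₁,s₂) ≠ Q`: `0 ≤ ĝ_q` and
`ĝ_q² (2 + cos(2πs₁/k) + cos(2πs₂/k)) ≤ (-ε/2)(2 - cos(2πs₁/k) - cos(2πs₂/k))`.
[cite: KLS1988JSP, eqs. (1), (12)–(19)] -/
theorem ir_fold (s₁ s₂ : ℕ) (hn : 2 ≤ n) (hL : 2 * n = m * k) (hs₁ : s₁ < k) (hs₂ : s₂ < k)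
    (hne : 2 * s₁ ≠ k ∨ 2 * s₂ ≠ k) (F : ℕ → ℕ → ℝ)
    (hF : ∀ ρ₁ ρ₂, F ρ₁ ρ₂ = ∑ a ∈ (range (2 * n)).filter (fun a => a % k = ρ₁),
        ∑ b ∈ (range (2 * n)).filter (fun b => b % k = ρ₂), heisRedCorr2 (2 * n) 1 a b) :
    0 ≤ ∑ ρ₁ ∈ range k, ∑ ρ₂ ∈ range k, cosNat k ((s₁ * ρ₁ + s₂ * ρ₂) % k) * F ρ₁ ρ₂ ∧
      (∑ ρ₁ ∈ range k, ∑ ρ₂ ∈ range k, cosNat k ((s₁ * ρ₁ + s₂ * ρ₂) % k) * F ρ₁ ρ₂) ^ 2 *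
          (2 + (cosNat k s₁ + cosNat k s₂)) ≤
        (-heisBondCorr (d := 2) 0 (2 * n) 1 / 2) * (2 - (cosNat k s₁ + cosNat k s₂)) := by
  haveI : NeZero (2 * n) := ⟨by omega⟩
  have hm : m ≠ 0 := by rintro rfl; omega
  have hk : k ≠ 0 := by rintro rfl; omega
  have hmpos : 0 < m := Nat.pos_of_ne_zero hm
  have hlt : ∀ s, s < k → m * s < 2 * n := fun s hs => by
    rw [hL]; exact Nat.mul_lt_mul_of_pos_left hs hmpos
  have hQ : (neelIndex (2 * n) : TorusSite 2 (2 * n)) =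
      ![((n : ℕ) : ZMod (2 * n)), ((n : ℕ) : ZMod (2 * n))] := by
    ext i; fin_cases i <;> simp [neelIndex, show 2 * n / 2 = n by omega]
  have hq : (![((m * s₁ : ℕ) : ZMod (2 * n)), ((m * s₂ : ℕ) : ZMod (2 * n))] : TorusSite 2 (2 * n)) ≠
      neelIndex (2 * n) := by
    rw [hQ]
    intro h
    have h0 := congr_fun h 0
    have h1 := congr_fun h 1
    simp only [Matrix.cons_val_zero, Matrix.cons_val_one] at h0 h1
    rw [ZMod.natCast_eq_natCast_iff', Nat.mod_eq_of_lt (hlt s₁ hs₁), Nat.mod_eq_of_lt (by omega)] at h0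
    rw [ZMod.natCast_eq_natCast_iff', Nat.mod_eq_of_lt (hlt s₂ hs₂), Nat.mod_eq_of_lt (by omega)] at h1
    have e1 : 2 * s₁ = k := Nat.eq_of_mul_eq_mul_left hmpos (by
      calc m * (2 * s₁) = 2 * (m * s₁) := by ring
        _ = m * k := by rw [h0, hL])
    have e2 : 2 * s₂ = k := Nat.eq_of_mul_eq_mul_left hmpos (by
      calc m * (2 * s₂) = 2 * (m * s₂) := by ring
        _ = m * k := by rw [h1, hL])
    rcases hne with h' | h' <;> contradiction
  have hI := heis_infraredBound (d := 2) (by norm_num) 1 n hn _ hq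
  rw [heisStructureFactor_fold n m k s₁ s₂ hL hm hk F hF, dispersion_latticeMomentum_sub_neelIndex,
    dispersion_latticeMomentum_eq, torusCosSum_two_natCast, cosNat_fold (2 * n) m k s₁ hL hm hk,
    cosNat_fold (2 * n) m k s₂ hL hm hk, Nat.mod_eq_of_lt hs₁, Nat.mod_eq_of_lt hs₂] at hI
  simpa only [Nat.cast_ofNat] using hI

/-- **Folded infrared bound, tangent form**: for every `g₀`,
`2g₀ ĝ_q ≤ g₀² + (E_q / 2E_(q-Q)) (-ε)` (from `ĝ_q² ≤ (E_q/2E_(q-Q))(-ε)` and `(ĝ_q - g₀)² ≥ 0`).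
[cite: KLS1988JSP, eqs. (1), (12)–(19)] -/
theorem ir_fold_tangent (s₁ s₂ : ℕ) (hn : 2 ≤ n) (hL : 2 * n = m * k) (hs₁ : s₁ < k) (hs₂ : s₂ < k)
    (hne : 2 * s₁ ≠ k ∨ 2 * s₂ ≠ k) (hE : 0 < 2 + (cosNat k s₁ + cosNat k s₂)) (F : ℕ → ℕ → ℝ)
    (hF : ∀ ρ₁ ρ₂, F ρ₁ ρ₂ = ∑ a ∈ (range (2 * n)).filter (fun a => a % k = ρ₁),
        ∑ b ∈ (range (2 * n)).filter (fun b => b % k = ρ₂), heisRedCorr2 (2 * n) 1 a b) (g₀ : ℝ) :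
    2 * g₀ * (∑ ρ₁ ∈ range k, ∑ ρ₂ ∈ range k, cosNat k ((s₁ * ρ₁ + s₂ * ρ₂) % k) * F ρ₁ ρ₂) ≤
      g₀ ^ 2 + (2 - (cosNat k s₁ + cosNat k s₂)) / (2 * (2 + (cosNat k s₁ + cosNat k s₂))) *
        (-heisBondCorr (d := 2) 0 (2 * n) 1) := by
  obtain ⟨-, h⟩ := ir_fold n m k s₁ s₂ hn hL hs₁ hs₂ hne F hF
  set G := ∑ ρ₁ ∈ range k, ∑ ρ₂ ∈ range k, cosNat k ((s₁ * ρ₁ + s₂ * ρ₂) % k) * F ρ₁ ρ₂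
  set C := cosNat k s₁ + cosNat k s₂
  have h1 : G ^ 2 ≤ (2 - C) / (2 * (2 + C)) * (-heisBondCorr (d := 2) 0 (2 * n) 1) := by
    rw [div_mul_eq_mul_div, le_div_iff₀ (by positivity)]
    nlinarith [h]
  nlinarith [sq_nonneg (G - g₀), h1]

/-- **Singlet rule, folded**: `Σ_ρ F(ρ) = ĝ_0 = 0` (the infrared bound at `q = 0`, where
`E_0 = 0`, together with `ĝ_0 ≥ 0`). [cite: KLS1988JSP, eqs. (1), (12)–(19)] -/
theorem fold_singlet (hn : 2 ≤ n) (hL : 2 * n = m * k) (hk : 0 < k) (F : ℕ → ℕ → ℝ)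
    (hF : ∀ ρ₁ ρ₂, F ρ₁ ρ₂ = ∑ a ∈ (range (2 * n)).filter (fun a => a % k = ρ₁),
        ∑ b ∈ (range (2 * n)).filter (fun b => b % k = ρ₂), heisRedCorr2 (2 * n) 1 a b) :
    ∑ ρ₁ ∈ range k, ∑ ρ₂ ∈ range k, F ρ₁ ρ₂ = 0 := by
  obtain ⟨h0, h⟩ := ir_fold n m k 0 0 hn hL hk hk (Or.inl (by omega)) F hF
  have e : ∑ ρ₁ ∈ range k, ∑ ρ₂ ∈ range k, cosNat k ((0 * ρ₁ + 0 * ρ₂) % k) * F ρ₁ ρ₂ =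
      ∑ ρ₁ ∈ range k, ∑ ρ₂ ∈ range k, F ρ₁ ρ₂ := by
    refine sum_congr rfl fun ρ₁ _ => sum_congr rfl fun ρ₂ _ => ?_
    rw [zero_mul, zero_mul, add_zero, Nat.zero_mod, show cosNat k 0 = 1 by simp [cosNat], one_mul]
  rw [e, show cosNat k 0 = 1 by simp [cosNat]] at h
  rw [e] at h0
  nlinarith [h0, h]

end Fold

/-! ### Marshall's sign rule on the residue classes -/

/-- Parity is constant on a residue class mod an even `k`. [folklore] -/
theorem foldClass_parity {k ρ₁ ρ₂ a b : ℕ} (hk : 2 ∣ k) (ha : a % k = ρ₁) (hb : b % k = ρ₂) :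
    2 ∣ a + b ↔ 2 ∣ ρ₁ + ρ₂ := by
  obtain ⟨j, rfl⟩ := hk
  have ha' : 2 * (j * (a / (2 * j))) + ρ₁ = a := by
    rw [← mul_assoc, ← ha]; exact Nat.div_add_mod a (2 * j)
  have hb' : 2 * (j * (b / (2 * j))) + ρ₂ = b := by
    rw [← mul_assoc, ← hb]; exact Nat.div_add_mod b (2 * j)
  generalize j * (a / (2 * j)) = t at ha'
  generalize j * (b / (2 * j)) = u at hb'
  omega

section Marshall

variable (n k : ℕ) [NeZero (2 * n)] (F : ℕ → ℕ → ℝ)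
  (hF : ∀ ρ₁ ρ₂, F ρ₁ ρ₂ = ∑ a ∈ (range (2 * n)).filter (fun a => a % k = ρ₁),
      ∑ b ∈ (range (2 * n)).filter (fun b => b % k = ρ₂), heisRedCorr2 (2 * n) 1 a b)
include hF

/-- (M) An even class sum is nonnegative. [cite: LiebMattis1962, Theorem 2] -/
theorem foldClass_nonneg (hk : 2 ∣ k) (ρ₁ ρ₂ : ℕ) (hρ : 2 ∣ ρ₁ + ρ₂) : 0 ≤ F ρ₁ ρ₂ := by
  rw [hF]
  exact sum_nonneg fun a ha => sum_nonneg fun b hb =>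
    heisRedCorr2_nonneg_of_even (2 * n) (dvd_mul_right 2 n) 1 a b
      ((foldClass_parity hk (mem_filter.1 ha).2 (mem_filter.1 hb).2).2 hρ)

/-- (M) An odd class sum is nonpositive. [cite: LiebMattis1962, Theorem 2] -/
theorem foldClass_nonpos (hk : 2 ∣ k) (ρ₁ ρ₂ : ℕ) (hρ : ¬ 2 ∣ ρ₁ + ρ₂) : F ρ₁ ρ₂ ≤ 0 := by
  rw [hF]
  exact sum_nonpos fun a ha => sum_nonpos fun b hb =>
    heisRedCorr2_nonpos_of_odd (2 * n) (dvd_mul_right 2 n) 1 a b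
      (fun h => hρ ((foldClass_parity hk (mem_filter.1 ha).2 (mem_filter.1 hb).2).1 h))

/-- (T)+(M) The class of the origin: `F(0,0) ≥ c(0,0) = ¼`.
[cite: KLS1988JSP, eqs. (15)–(25)] [cite: LiebMattis1962, Theorem 2] -/
theorem foldClass_zero_zero_ge (hk : 2 ∣ k) : 1 / 4 ≤ F 0 0 := by
  have hn : 0 < 2 * n := Nat.pos_of_ne_zero (NeZero.ne _)
  have h0 : (0 : ℕ) ∈ (range (2 * n)).filter (fun a => a % k = 0) :=
    mem_filter.2 ⟨mem_range.2 hn, Nat.zero_mod k⟩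
  have hnn : ∀ a ∈ (range (2 * n)).filter (fun a => a % k = 0),
      ∀ b ∈ (range (2 * n)).filter (fun b => b % k = 0), 0 ≤ heisRedCorr2 (2 * n) 1 a b :=
    fun a ha b hb => heisRedCorr2_nonneg_of_even (2 * n) (dvd_mul_right 2 n) 1 a b
      ((foldClass_parity hk (mem_filter.1 ha).2 (mem_filter.1 hb).2).2 (dvd_zero 2))
  rw [hF]
  calc (1 : ℝ) / 4 = heisRedCorr2 (2 * n) 1 0 0 := by rw [heisRedCorr2_zero_zero]; norm_num
    _ ≤ ∑ b ∈ (range (2 * n)).filter (fun b => b % k = 0), heisRedCorr2 (2 * n) 1 0 b :=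
        single_le_sum (f := fun b => heisRedCorr2 (2 * n) 1 0 b) (fun b hb => hnn 0 h0 b hb) h0
    _ ≤ ∑ a ∈ (range (2 * n)).filter (fun a => a % k = 0),
          ∑ b ∈ (range (2 * n)).filter (fun b => b % k = 0), heisRedCorr2 (2 * n) 1 a b :=
        single_le_sum (f := fun a => ∑ b ∈ (range (2 * n)).filter (fun b => b % k = 0),
            heisRedCorr2 (2 * n) 1 a b) (fun a ha => sum_nonneg fun b hb => hnn a ha b hb) h0

omit hF in
/-- A sum of nonpositive terms is at most any one of them. [folklore] -/
private theorem sum_le_mem_of_nonpos {s : Finset ℕ} {f : ℕ → ℝ} (h : ∀ i ∈ s, f i ≤ 0) {i : ℕ}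
    (hi : i ∈ s) : ∑ j ∈ s, f j ≤ f i := by
  rw [← add_sum_erase s f hi]
  have : ∑ j ∈ s.erase i, f j ≤ 0 := sum_nonpos fun j hj => h j (mem_of_mem_erase hj)
  linarith

/-- (M) An odd class sum is at most any one of its members `c(a₀,b₀)`.
[cite: LiebMattis1962, Theorem 2] -/
theorem foldClass_le_single (hk : 2 ∣ k) (ρ₁ ρ₂ a₀ b₀ : ℕ) (hρ : ¬ 2 ∣ ρ₁ + ρ₂)
    (ha₀ : a₀ < 2 * n) (ha : a₀ % k = ρ₁) (hb₀ : b₀ < 2 * n) (hb : b₀ % k = ρ₂) :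
    F ρ₁ ρ₂ ≤ heisRedCorr2 (2 * n) 1 a₀ b₀ := by
  have hnp : ∀ a ∈ (range (2 * n)).filter (fun a => a % k = ρ₁),
      ∀ b ∈ (range (2 * n)).filter (fun b => b % k = ρ₂), heisRedCorr2 (2 * n) 1 a b ≤ 0 :=
    fun a ha b hb => heisRedCorr2_nonpos_of_odd (2 * n) (dvd_mul_right 2 n) 1 a b
      (fun h => hρ ((foldClass_parity hk (mem_filter.1 ha).2 (mem_filter.1 hb).2).1 h))
  have hma : a₀ ∈ (range (2 * n)).filter (fun a => a % k = ρ₁) := mem_filter.2 ⟨mem_range.2 ha₀, ha⟩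
  have hmb : b₀ ∈ (range (2 * n)).filter (fun b => b % k = ρ₂) := mem_filter.2 ⟨mem_range.2 hb₀, hb⟩
  rw [hF]
  calc _ ≤ ∑ b ∈ (range (2 * n)).filter (fun b => b % k = ρ₂), heisRedCorr2 (2 * n) 1 a₀ b :=
        sum_le_mem_of_nonpos (f := fun a => ∑ b ∈ (range (2 * n)).filter (fun b => b % k = ρ₂),
          heisRedCorr2 (2 * n) 1 a b) (fun a ha => sum_nonpos fun b hb => hnp a ha b hb) hma
    _ ≤ _ := sum_le_mem_of_nonpos (f := fun b => heisRedCorr2 (2 * n) 1 a₀ b)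
          (fun b hb => hnp a₀ hma b hb) hmb

end Marshall

/-- Inversion symmetry at the unit vectors: `c(0, L-1) = c(0,1)` on the `2n`-torus (`n ≥ 1`).
[cite: KLS1988JSP, eqs. (15)–(25)] -/
theorem heisRedCorr2_zero_pred (n : ℕ) [NeZero (2 * n)] (hn : 1 ≤ n) :
    heisRedCorr2 (2 * n) 1 0 (2 * n - 1) = heisRedCorr2 (2 * n) 1 0 1 := by
  have h := heisRedCorr2_neg_mod (2 * n) 1 0 1
  have e0 : (2 * n - 0 % (2 * n)) % (2 * n) = 0 := by simp
  have e1 : (2 * n - 1 % (2 * n)) % (2 * n) = 2 * n - 1 := by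
    rw [Nat.mod_eq_of_lt (show 1 < 2 * n by omega), Nat.mod_eq_of_lt (show 2 * n - 1 < 2 * n by omega)]
  rw [e0, e1] at h
  exact h.symm

/-- Inversion symmetry at the unit vectors: `c(L-1, 0) = c(1,0)` on the `2n`-torus (`n ≥ 1`).
[cite: KLS1988JSP, eqs. (15)–(25)] -/
theorem heisRedCorr2_pred_zero (n : ℕ) [NeZero (2 * n)] (hn : 1 ≤ n) :
    heisRedCorr2 (2 * n) 1 (2 * n - 1) 0 = heisRedCorr2 (2 * n) 1 1 0 := by
  rw [heisRedCorr2_swap, heisRedCorr2_zero_pred n hn, heisRedCorr2_swap]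

/-- (M) The nearest-neighbour correlations are nonpositive: `c(0,1) ≤ 0`, `c(1,0) ≤ 0`.
[cite: LiebMattis1962, Theorem 2] -/
theorem heisRedCorr2_unit_nonpos (n : ℕ) [NeZero (2 * n)] :
    heisRedCorr2 (2 * n) 1 0 1 ≤ 0 ∧ heisRedCorr2 (2 * n) 1 1 0 ≤ 0 :=
  ⟨heisRedCorr2_nonpos_of_odd (2 * n) (dvd_mul_right 2 n) 1 0 1 (by norm_num),
   heisRedCorr2_nonpos_of_odd (2 * n) (dvd_mul_right 2 n) 1 1 0 (by norm_num)⟩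

end Summit.HubbardSuperconductivity.HubbardLadder
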